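import Literature.AlgebraicGeometry.Frobenioids.ArchimedeanFrobenioidRelative
import Literature.AlgebraicGeometry.Frobenioids.IsometryWideSubcategoryFrobenioid
import Literature.AlgebraicGeometry.Frobenioids.FiberProductsMorphisms
import HarnessLib

/-!
# Frobenioids II, Example 3.3 (iii): `A₀` and `A = A₀ ×_{D₀} D` are Frobenioids (discharge of `Ex33iii_isFrobenioid`)

Mochizuki, *The geometry of Frobenioids II: poly-Frobenioids*, Kyushu J. Math. **62** (2008)
401–460, §3, Example 3.3 (iii), author's text pp. 28–29: "Write `A₀` (respectively, `A`) for the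
subcategory of `C₀` (respectively, `C`) determined by the *isometries* … a routine verification
reveals that `A` satisfies the conditions of [Mzk5], Definition 1.3, hence that `A` is a *Frobenioid*
over the base category `D`" [cite: MochizukiFrdII2008, Ex 3.3 (iii) p.29].  PROOF-ONLY file (no
definition): the one input of the generic verification (`PreFrobenioid.Isometries.isFrobenioid_of`)
that is special to the Archimedean Frobenioids — base-isomorphic objects receive ISOMETRIC pre-steps
from a common object — is checked for `C₀` (a small sector of `A` at the tip of `A`, mapped by
`(𝟙, 1, 1)` and by `(α, 1, w · λ_B/λ_A)` with a suitable rotation `w`) and lifted to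
`C = C₀ ×_{D₀} D`; whence `A₀ → F_0` and `A → F_0` (abc-iut-L1-t6's `ArchFrd.A0.toElem`,
`ArchFrd.A.toElem π`) are Frobenioids.  Discharges abc-iut-L1-t6's named statement
`ArchFrd.Ex33iii_isFrobenioid π` (HARD, deep pool).
-/

namespace Literature.AlgebraicGeometry.Frobenioids

open CategoryTheory Set
open scoped Pointwise

noncomputable section

namespace ArchFrd

namespace C0

/-- **Isometric form of [FrdI] Def. 1.3 (i)(b) for `C₀`**: for an isomorphism `α : A_D ⥲ B_D` of
`D₀` there are ISOMETRIC pre-steps `φ : X → A`, `ψ : X → B` with `α ∘ Base(φ) = Base(ψ)`: `X` is a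
small sector of `A` with the tip of `A` (complex case; `φ = (𝟙, 1, 1)`, `ψ = (α, 1, w λ_B/λ_A)` for a
rotation `w` moving the sector into `B|_α`) or `A` itself (real case).
[cite: MochizukiFrdII2008, Ex 3.3 (iii) p.29] -/
theorem exists_isometric_preSteps (A B : C0) (α : A.base ≅ B.base) :
    ∃ (X : C0) (φ : X ⟶ A) (ψ : X ⟶ B), PreFrobenioid.IsIsometricPreStep toElem φ ∧
      PreFrobenioid.IsIsometricPreStep toElem ψ ∧ Base φ ≫ α.hom = Base ψ := by
  obtain ⟨A', hA'c, hA't, hA'd, hA'i⟩ := exists_pulledRegion B α.hom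
  obtain ⟨p, hp⟩ := A.region.dir_nonempty
  obtain ⟨q, hq⟩ := A'.dir_nonempty
  -- the ratio of the tips, as a positive real scalar
  have hnt : ‖((ofPosReal ℂ (B.region.tip * A.region.tip⁻¹) : ℂˣ) : ℂ)‖ * A.tip = B.tip := by
    rw [coe_ofPosReal, RCLike.norm_ofReal, Positive.val_mul, Positive.coe_inv, tip_eq, tip_eq,
      abs_of_pos (mul_pos B.region.tip.2 (inv_pos.2 A.region.tip.2)),
      inv_mul_cancel_right₀ A.region.tip.2.ne']
  rcases D0.isReal_or_isComplex A.base with hA | hA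
  · -- real case: `X := A`, `φ := 𝟙`, `ψ := (α, 1, λ_B/λ_A)`
    have hB : A'.IsIsotropic :=
      hA'i (isNaivelyIsotropic_of_isRealObj (D0.eq_real_of_hom_real (by rw [← hA]; exact α.hom)))
    obtain ⟨ψ, hψb, hψd, hψc⟩ := exists_hom A B α.hom 1
      (c := ofPosReal ℂ (B.region.tip * A.region.tip⁻¹)) (ofPosReal_mem_scalars _ _) hA'c
      (by rw [show A'.dir = univ from hB]; exact Set.subset_univ _)
      (by rw [PNat.one_coe, pow_one, hA't, ← tip_eq]; exact hnt.le)
    have hψp : PreFrobenioid.IsPreStep toElem ψ := by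
      refine ⟨hψd, ?_⟩
      rw [isBaseIso_iff, hψb]
      infer_instance
    have hψi : PreFrobenioid.IsIsometry toElem ψ := by
      rw [isIsometry_iff, hψc, hψd, PNat.one_coe, pow_one]
      exact hnt
    refine ⟨A, 𝟙 A, ψ, PreFrobenioid.isIsometricPreStep_of_isIso preFrobenioidStructure_holds _,
      ⟨hψi, hψp⟩, ?_⟩
    rw [hψb]
    exact Category.id_comp _
  · -- complex case: a small sector of `A` around `p`, inside `w⁻¹ · (B|_α)`
    let w : normOneSubgroup ℂ := q * p⁻¹
    have hU : IsOpen (A.region.dir ∩ w⁻¹ • A'.dir) :=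
      A.region.isOpen_dir.inter (isOpen_smul _ A'.isOpen_dir)
    have hpU : p ∈ A.region.dir ∩ w⁻¹ • A'.dir :=
      ⟨hp, ⟨q, hq, by show (q * p⁻¹)⁻¹ • q = p; rw [smul_eq_mul, mul_inv_rev, inv_inv,
        inv_mul_cancel_right]⟩⟩
    obtain ⟨V, hVo, hVc, hpV, hVU⟩ := exists_isConnected_isOpen_subset hU hpU
    obtain ⟨AX, hAXd, hAXt⟩ := exists_angularRegion hVo hVc A.region.tip
    let X : C0 := ⟨A.base, AX, isIsotropic_of_isReal_absurd hA AX⟩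
    -- `φ = (𝟙, 1, 1)`
    obtain ⟨A'', hA''c, hA''t, hA''d, -⟩ := exists_pulledRegion A (𝟙 A.base)
    rw [twist_id_image] at hA''d
    obtain ⟨φ, hφb, hφd, hφc⟩ := exists_hom X A (𝟙 A.base) 1 (one_mem _) hA''c
      (by
        rw [hA''d, unitPart_one, one_smul, PNat.one_coe, pow_one]
        change AX.dir ⊆ A.region.dir
        rw [hAXd]; exact hVU.trans Set.inter_subset_left)
      (by
        rw [hA''t, Units.val_one, norm_one, one_mul, PNat.one_coe, pow_one]
        change ((AX.tip : PosReal) : ℝ) ≤ _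
        rw [hAXt])
    -- `ψ = (α, 1, w λ_B/λ_A)`
    have hn : ‖(((w : ℂˣ) * ofPosReal ℂ (B.region.tip * A.region.tip⁻¹) : ℂˣ) : ℂ)‖ * A.tip = B.tip := by
      rw [Units.val_mul, norm_mul, show ‖((w : ℂˣ) : ℂ)‖ = 1 from (mem_normOneSubgroup_iff ℂ _).1 w.2,
        one_mul]
      exact hnt
    obtain ⟨ψ, hψb, hψd, hψc⟩ := exists_hom X B α.hom 1
      (c := (w : ℂˣ) * ofPosReal ℂ (B.region.tip * A.region.tip⁻¹))
      (by rw [show X.base = D0.complex from hA, D0.scalars_complex]; trivial) hA'c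
      (by
        rw [(unitPart_absHom_polar w _).1, PNat.one_coe, pow_one]
        change w • AX.dir ⊆ A'.dir
        rw [hAXd]
        refine (Set.smul_set_mono (hVU.trans Set.inter_subset_right)).trans ?_
        rw [smul_smul, mul_inv_cancel, one_smul])
      (by
        rw [PNat.one_coe, pow_one, hA't, ← tip_eq]
        change _ * ((AX.tip : PosReal) : ℝ) ≤ _
        rw [hAXt, ← tip_eq]
        exact hn.le)
    have hφp : PreFrobenioid.IsPreStep toElem φ := by
      refine ⟨hφd, ?_⟩
      rw [isBaseIso_iff, hφb]
      infer_instance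
    have hψp : PreFrobenioid.IsPreStep toElem ψ := by
      refine ⟨hψd, ?_⟩
      rw [isBaseIso_iff, hψb]
      infer_instance
    have hφi : PreFrobenioid.IsIsometry toElem φ := by
      rw [isIsometry_iff, hφc, hφd, PNat.one_coe, pow_one, Units.val_one, norm_one, one_mul]
      change ((AX.tip : PosReal) : ℝ) = _
      rw [hAXt, tip_eq]
    have hψi : PreFrobenioid.IsIsometry toElem ψ := by
      rw [isIsometry_iff, hψc, hψd, PNat.one_coe, pow_one]
      change _ * ((AX.tip : PosReal) : ℝ) = _
      rw [hAXt, ← tip_eq]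
      exact hn
    refine ⟨X, φ, ψ, ⟨hφi, hφp⟩, ⟨hψi, hψp⟩, ?_⟩
    rw [hφb, hψb]
    exact Category.id_comp _

/-- **`A₀ → F_0` is a Frobenioid** (the isometries of `C₀`, over the zero monoid on `D₀`; [FrdII]
Ex. 3.3 (iii) in the absolute case). [cite: MochizukiFrdII2008, Ex 3.3 (iii) p.29] -/
theorem isFrobenioid_isometries : PreFrobenioid.IsFrobenioid A0.toElem :=
  PreFrobenioid.Isometries.isFrobenioid_of isFrobenioid exists_isometric_preSteps

end C0

universe v u

variable {D : Type u} [Category.{v} D] (π : D ⥤ D0)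

namespace C

/-- **Isometric form of [FrdI] Def. 1.3 (i)(b) for `C = C₀ ×_{D₀} D`**: lift the sector object of
`C₀` over the given `D`-isomorphism. [cite: MochizukiFrdII2008, Ex 3.3 (iii) p.29] -/
theorem exists_isometric_preSteps (A B : C π)
    (α : PreFrobenioid.baseObj (C.toElem π) A ≅ PreFrobenioid.baseObj (C.toElem π) B) :
    ∃ (X : C π) (φ : X ⟶ A) (ψ : X ⟶ B), PreFrobenioid.IsIsometricPreStep (C.toElem π) φ ∧
      PreFrobenioid.IsIsometricPreStep (C.toElem π) ψ ∧
        PreFrobenioid.Base (C.toElem π) φ ≫ α.hom = PreFrobenioid.Base (C.toElem π) ψ := by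
  let α' : A.snd ≅ B.snd := α
  let β₀ : A.fst.base ≅ B.fst.base := A.e ≪≫ π.mapIso α' ≪≫ B.e.symm
  obtain ⟨X₀, φ₀, ψ₀, hφ₀, hψ₀, hb₀⟩ := C0.exists_isometric_preSteps A.fst B.fst β₀
  haveI : IsIso (C0.Base φ₀) := hφ₀.2.2
  haveI : IsIso (C0.Base ψ₀) := hψ₀.2.2
  have hb₀' : C0.Base ψ₀ ≫ B.e.hom = (C0.Base φ₀ ≫ A.e.hom) ≫ π.map α'.hom := by
    rw [← hb₀]
    show (C0.Base φ₀ ≫ A.e.hom ≫ π.map α'.hom ≫ B.e.inv) ≫ B.e.hom = _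
    simp only [Category.assoc, Iso.inv_hom_id, Category.comp_id]
  let X : C π := PreFrobenioid.FiberProduct.liftSrc A φ₀ hφ₀.2.2
  let φ : X ⟶ A := PreFrobenioid.FiberProduct.liftSrcHom A φ₀ hφ₀.2.2
  let ψ : X ⟶ B := ⟨ψ₀, α'.hom, hb₀'⟩
  have hφb : PreFrobenioid.IsBaseIso (C.toElem π) φ := by
    show IsIso (𝟙 A.snd)
    infer_instance
  have hψb : PreFrobenioid.IsBaseIso (C.toElem π) ψ := by
    show IsIso α'.hom
    infer_instance
  refine ⟨X, φ, ψ,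
    ⟨(PreFrobenioid.isIsometry_fiberProduct_iff φ).2 hφ₀.1,
      (PreFrobenioid.isPreStep_fiberProduct_iff φ hφb).2 hφ₀.2⟩,
    ⟨(PreFrobenioid.isIsometry_fiberProduct_iff ψ).2 hψ₀.1,
      (PreFrobenioid.isPreStep_fiberProduct_iff ψ hψb).2 hψ₀.2⟩, ?_⟩
  show 𝟙 A.snd ≫ α'.hom = α'.hom
  exact Category.id_comp _

end C

/-- **[FrdII] Example 3.3 (iii): `A = A₀ ×_{D₀} D` (the isometries of `C`) is a Frobenioid over `D`**,
for `D` connected and totally epimorphic — discharge of abc-iut-L1-t6's named statement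
`ArchFrd.Ex33iii_isFrobenioid`. [cite: MochizukiFrdII2008, Ex 3.3 (iii) p.29] -/
theorem Ex33iii_isFrobenioid_holds : Ex33iii_isFrobenioid π := fun hDc hDe =>
  PreFrobenioid.Isometries.isFrobenioid_of (Ex33ii_isFrobenioid_holds π hDc hDe)
    (C.exists_isometric_preSteps π)

end ArchFrd

end

end Literature.AlgebraicGeometry.Frobenioids
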